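import Summits.HubbardSuperconductivity.HubbardLadder.R3R4SoundMultiplet
import HarnessLib

/-!
# Rung R3 — soundness of the ED-enclosure certificate: residual + complement gap ⇒ correlator window

(The r3 seat's `R3R4Sound` split into four files for the 400-line limit, statements unchanged:
`R3R4SoundLinAlg` = §1, `R3R4SoundWindow` = §2–§4, `R3R4SoundMultiplet` = §5, `R3R4Sound` = §6 +
the overview docstring; import `R3R4Sound` to get everything. The `ℓ²` norm is the tree's
`Literature.MathematicalPhysics.QuantumLattice.eucNorm` (`ApproximateEigenvectorLemmas`) and the observable
enclosure is a corollary of `GroundStateEnclosure.norm_expect_sub_expect_le`; the Davis–Kahan bound here,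
`eucNorm_sub_proj_le_of_complement_gap`, is the variant of `GroundStateEnclosure.eucNorm_sub_proj_le_of_residual`
with the gap hypothesis on the TRIAL vector's complement inside a sector and the conclusion for every sector
ground state, which is the shape a certificate producer supplies.)

HONEST FRAMING (page 1): ladder R1–R4 with certified numbers; no claim on H/H₀. This file proves the
SOUNDNESS THEOREM of the one certificate format that is amplitude-exact at `L = 4` (R3-DESIGN §8,
"R3-0-ED"): a certified approximate sector ground state `φ` (unit, in the sector `K`), a certified
residual `‖H φ - σ φ‖ ≤ ε`, a certified Rayleigh value `re ⟨φ, H φ⟩ ≤ ρ`, and a certified lower bound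
`β > ρ` on the Rayleigh quotient of `H` on `K ∩ φ^⊥` (the hard input: a second-eigenvalue / complement
bound) imply that EVERY normalised sector ground state `ψ` lies within `δ = ε / (β - ρ)` of `ℂφ`
(Davis–Kahan / Kato–Temple type argument, no spectral theorem needed), hence every bounded
observable is pinned: `|⟨ψ, O ψ⟩ - ⟨φ, O φ⟩| ≤ 2 M (δ + δ²)` for `|⟨u, O v⟩| ≤ M ‖u‖ ‖v‖`. Applied to
`O_r = Σ_x P_x† P_{x+r}` (`M = L² C_d²`, `C_d` the tree's local-pair norm constant) this is a
`PairCorrWindowCert` (tree, `R3R4Props`) with `lo/hi = c∓ ∓ 2 C_d² (δ + δ²)` from a certified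
enclosure `c⁻ ≤ P̄_d(L, r; φ) ≤ c⁺`. Also: the ground-state positivity block (`⟨ψ, a†[H, a] ψ⟩ ≥ 0`
for sector-preserving words `a`), the missing PSD block of the energy-window relaxations
(R4-MEMO M3), and `complement_of_shifted_lower_bound` (the hard input `β` as a PSD statement
`H + c φφ† - β ⪰ 0` on the sector). §5 is the MULTIPLET format for a degenerate or nearly degenerate
sector ground level (likely on the `t' = 0` side: the 4×4 nearest-neighbour torus graph is the 4-cube):
an orthonormal family `φ₁ … φ_m`, `E_K ≤ ρ < β` with `β` bounding `H` below on `K ∩ {φ_i}^⊥`, gives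
`‖ψ - Σ ⟨φ_i, ψ⟩ φ_i‖ ≤ m ε / (β - ρ)` and a window from an enclosure of the correlator over the
near-unit vectors of the span (`ResidualComplementMultipletData.toWindow`). §6: producer-facing
constructors `ResidualComplementData.ofUnnormalised` / `ResidualComplementMultipletData.ofOrthogonal`
from unnormalised (e.g. exact rational) vectors resp. orthogonal-not-orthonormal families, with every
inequality scaled by `s_i = ⟨v_i, v_i⟩` so that it is an inequality between rationals, and
`value_range_of_form_bounds` reducing the span enclosure to two quadratic-form (`m × m` PSD) checks.
No certificate exists; these are soundness edges.
-/

namespace Summit.HubbardSuperconductivity.HubbardLadder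

open Matrix Finset Filter Literature.Probability.LatticeModels
  Literature.MathematicalPhysics.QuantumLattice
open scoped ComplexOrder Topology InnerProductSpace

noncomputable section

/-! ## §6 Producer-facing constructors from unnormalised (e.g. exact rational) vectors

Exact-arithmetic producers supply vectors with rational entries, which are essentially never unit, and
for multiplets ORTHOGONAL rather than orthonormal families (Gram–Schmidt without normalisation stays
rational). The constructors below take such data with every certificate inequality multiplied through
by the squared norms `s_i = ⟨v_i, v_i⟩` — each is then an inequality between rationals when `H`, `v`,
`σ` and the bounds are rational — and build the §3 / §5 certificates for `φ_i = v_i / ‖v_i‖`;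
`value_range_of_form_bounds` reduces the span enclosure of §5 to two quadratic-form inequalities in the
coefficients (i.e. two `m × m` PSD checks for the producer). -/

section Unnormalised

variable {n : Type*} [Fintype n]

/-- `⟨v, v⟩ = s ⇒ ‖v‖² = s`. [folklore] -/
theorem eucNorm_sq_eq_of_star_dotProduct_self {v : n → ℂ} {s : ℝ} (hs : star v ⬝ᵥ v = (s : ℂ)) :
    eucNorm v ^ 2 = s := by
  have h := star_dotProduct_self_eq_eucNorm_sq v
  rw [hs] at h
  exact_mod_cast h.symm

/-- `‖v‖² = s > 0 ⇒ ‖v‖ ≠ 0`. [folklore] -/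
theorem eucNorm_ne_zero_of_sq_eq {v : n → ℂ} {s : ℝ} (hv2 : eucNorm v ^ 2 = s) (hs0 : 0 < s) :
    eucNorm v ≠ 0 := fun h => by rw [h] at hv2; norm_num at hv2; linarith

/-- The normalisation scalar `‖v‖⁻¹` as a complex number. [folklore] -/
def normScalar (v : n → ℂ) : ℂ := (((eucNorm v)⁻¹ : ℝ) : ℂ)

/-- `‖v‖⁻² · s = 1` when `‖v‖² = s > 0`. [folklore] -/
theorem normScalar_sq_mul {v : n → ℂ} {s : ℝ} (hv2 : eucNorm v ^ 2 = s) (hs0 : 0 < s) :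
    (eucNorm v)⁻¹ ^ 2 * s = 1 := by
  have := eucNorm_ne_zero_of_sq_eq hv2 hs0
  rw [← hv2]; field_simp

/-- Rayleigh value of the normalised vector from the scaled inequality. [folklore] -/
theorem re_rayleigh_normalize_le {A : Matrix n n ℂ} {v : n → ℂ} {ρ s : ℝ}
    (hv2 : eucNorm v ^ 2 = s) (hs0 : 0 < s) (h : (star v ⬝ᵥ A *ᵥ v).re ≤ ρ * s) :
    (star (normScalar v • v) ⬝ᵥ A *ᵥ (normScalar v • v)).re ≤ ρ := by
  unfold normScalar
  rw [re_star_smul_dotProduct_mulVec_smul]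
  calc (eucNorm v)⁻¹ ^ 2 * (star v ⬝ᵥ A *ᵥ v).re ≤ (eucNorm v)⁻¹ ^ 2 * (ρ * s) :=
        mul_le_mul_of_nonneg_left h (sq_nonneg _)
    _ = ρ := by rw [mul_left_comm, normScalar_sq_mul hv2 hs0, mul_one]

/-- Residual of the normalised vector from the scaled squared inequality. [folklore] -/
theorem eucNorm_residual_normalize_le {A : Matrix n n ℂ} {v : n → ℂ} {σ : ℂ} {ε s : ℝ}
    (hv2 : eucNorm v ^ 2 = s) (hs0 : 0 < s) (hε : 0 ≤ ε)
    (h : eucNorm (A *ᵥ v - σ • v) ^ 2 ≤ ε ^ 2 * s) :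
    eucNorm (A *ᵥ (normScalar v • v) - σ • (normScalar v • v)) ≤ ε := by
  have hn0 := eucNorm_ne_zero_of_sq_eq hv2 hs0
  have hres : eucNorm (A *ᵥ v - σ • v) ≤ ε * eucNorm v := by
    have h2 : eucNorm (A *ᵥ v - σ • v) ^ 2 ≤ (ε * eucNorm v) ^ 2 := by rw [mul_pow, hv2]; exact h
    have h3 := sq_le_sq.1 h2
    rwa [abs_of_nonneg (eucNorm_nonneg _), abs_of_nonneg (mul_nonneg hε (eucNorm_nonneg v))] at h3
  have heq : A *ᵥ (normScalar v • v) - σ • (normScalar v • v) = normScalar v • (A *ᵥ v - σ • v) := by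
    rw [mulVec_smul, smul_sub, smul_comm σ]
  rw [heq, eucNorm_smul, normScalar, Complex.norm_real, Real.norm_eq_abs,
    abs_of_nonneg (inv_nonneg.2 (eucNorm_nonneg v))]
  calc (eucNorm v)⁻¹ * eucNorm (A *ᵥ v - σ • v) ≤ (eucNorm v)⁻¹ * (ε * eucNorm v) :=
        mul_le_mul_of_nonneg_left hres (inv_nonneg.2 (eucNorm_nonneg v))
    _ = ε := by field_simp

/-- Orthogonality to the normalised vector is orthogonality to `v`. [folklore] -/
theorem star_dotProduct_eq_zero_of_normalize {v w : n → ℂ} (hn0 : eucNorm v ≠ 0)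
    (h : star (normScalar v • v) ⬝ᵥ w = 0) : star v ⬝ᵥ w = 0 := by
  rw [star_smul, smul_dotProduct, smul_eq_zero] at h
  rcases h with h | h
  · exfalso
    rw [normScalar, star_eq_zero, Complex.ofReal_eq_zero, inv_eq_zero] at h
    exact hn0 h
  · exact h

/-- `v / ‖v‖` is a unit vector. [folklore] -/
theorem star_normScalar_smul_dotProduct_self {v : n → ℂ} (hn0 : eucNorm v ≠ 0) :
    star (normScalar v • v) ⬝ᵥ (normScalar v • v) = 1 :=
  star_normalize_dotProduct_self hn0

/-- Bilinear expansion of `⟨Σ aᵢ vᵢ, O Σ bⱼ vⱼ⟩`. [folklore] -/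
theorem star_sum_smul_dotProduct_mulVec_sum_smul {m : ℕ} (O : Matrix n n ℂ) (v : Fin m → n → ℂ)
    (a b : Fin m → ℂ) :
    star (∑ i, a i • v i) ⬝ᵥ O *ᵥ (∑ j, b j • v j) =
      ∑ i, ∑ j, star (a i) * b j * (star (v i) ⬝ᵥ O *ᵥ v j) := by
  rw [star_sum, sum_dotProduct]
  refine Finset.sum_congr rfl fun i _ => ?_
  rw [star_smul, smul_dotProduct, Matrix.mulVec_sum, dotProduct_sum, Finset.smul_sum]
  refine Finset.sum_congr rfl fun j _ => ?_
  rw [mulVec_smul, dotProduct_smul, smul_eq_mul, smul_eq_mul]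
  ring

/-- `‖Σ bᵢ vᵢ‖² = Σ |bᵢ|² sᵢ` for an orthogonal family with `⟨vᵢ, vᵢ⟩ = sᵢ`. [folklore] -/
theorem eucNorm_sq_sum_smul_orthogonal {m : ℕ} {v : Fin m → n → ℂ} {s : Fin m → ℝ}
    (horth : ∀ i j, star (v i) ⬝ᵥ v j = if i = j then ((s i : ℝ) : ℂ) else 0) (b : Fin m → ℂ) :
    eucNorm (∑ i, b i • v i) ^ 2 = ∑ i, ‖b i‖ ^ 2 * s i := by
  classical
  have h := star_dotProduct_self_eq_eucNorm_sq (∑ i, b i • v i)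
  have hexp : star (∑ i, b i • v i) ⬝ᵥ (∑ j, b j • v j) = ∑ i, star (b i) * b i * ((s i : ℝ) : ℂ) := by
    have := star_sum_smul_dotProduct_mulVec_sum_smul (1 : Matrix n n ℂ) v b b
    rw [Matrix.one_mulVec] at this
    rw [this]
    refine Finset.sum_congr rfl fun i _ => ?_
    simp_rw [Matrix.one_mulVec, horth, mul_ite, mul_zero]
    rw [Finset.sum_ite_eq]
    simp
  rw [hexp] at h
  have h' : ((∑ i, ‖b i‖ ^ 2 * s i : ℝ) : ℂ) = ((eucNorm (∑ i, b i • v i) ^ 2 : ℝ) : ℂ) := by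
    rw [← h]; push_cast
    refine Finset.sum_congr rfl fun i _ => ?_
    rw [Complex.star_def, ← Complex.conj_mul']
  exact_mod_cast h'.symm

variable {H : TorusHamiltonianFamily} {N : ℕ → ℕ} {L : ℕ} {r : Site 2}

/-- `P̄_d` is a real quadratic form: `P̄_d(L, r; c • v) = c² P̄_d(L, r; v)` for real `c`. [folklore] -/
theorem avgPairCorr_real_smul (L : ℕ) (r : Site 2) (c : ℝ) (v : Fock (Orb (FermionTorus 2 L))) :
    avgPairCorr L r ((c : ℂ) • v) = c ^ 2 * avgPairCorr L r v := by
  cases L with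
  | zero => simp [avgPairCorr]
  | succ k =>
    rw [avgPairCorr_eq_re_expect_pairCorrOp, avgPairCorr_eq_re_expect_pairCorrOp,
      re_star_smul_dotProduct_mulVec_smul, mul_div_assoc]

/-- **The §3 certificate from unnormalised data (proved).** Inputs: `v` in the sector with
`⟨v, v⟩ = s > 0`; `re ⟨v, H v⟩ ≤ ρ s`; `‖H v - σ v‖² ≤ ε² s` (`ε ≥ 0`); `ρ < β ≤` the Rayleigh quotient
on the unit sector vectors orthogonal to `v`; `c⁻ s ≤ P̄_d(L, r; v) ≤ c⁺ s`. [folklore] -/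
def ResidualComplementData.ofUnnormalised (v : Fock (Orb (FermionTorus 2 L))) (σ : ℂ)
    (ρ ε β clo chi s : ℝ) (herm : (H L).IsHermitian)
    (mem : v ∈ szSector (Λ := FermionTorus 2 L) (N L) 0) (hs : star v ⬝ᵥ v = (s : ℂ))
    (hs0 : 0 < s) (rayleigh_le : (star v ⬝ᵥ (H L) *ᵥ v).re ≤ ρ * s) (hε : 0 ≤ ε)
    (residual_sq_le : eucNorm ((H L) *ᵥ v - σ • v) ^ 2 ≤ ε ^ 2 * s) (gap : ρ < β)
    (complement : ∀ w ∈ szSector (Λ := FermionTorus 2 L) (N L) 0, star v ⬝ᵥ w = 0 →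
      star w ⬝ᵥ w = 1 → β ≤ (star w ⬝ᵥ (H L) *ᵥ w).re)
    (value_mem : clo * s ≤ avgPairCorr L r v ∧ avgPairCorr L r v ≤ chi * s) :
    ResidualComplementData H N L r :=
  have hv2 : eucNorm v ^ 2 = s := eucNorm_sq_eq_of_star_dotProduct_self hs
  have hn0 : eucNorm v ≠ 0 := eucNorm_ne_zero_of_sq_eq hv2 hs0
  { φ := normScalar v • v
    σ := σ
    ρ := ρ
    ε := ε
    β := β
    clo := clo
    chi := chi
    herm := herm
    mem := Submodule.smul_mem _ _ mem
    unit := star_normScalar_smul_dotProduct_self hn0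
    rayleigh_le := re_rayleigh_normalize_le hv2 hs0 rayleigh_le
    residual_le := eucNorm_residual_normalize_le hv2 hs0 hε residual_sq_le
    gap := gap
    complement := fun w hw hφw hw1 =>
      complement w hw (star_dotProduct_eq_zero_of_normalize hn0 hφw) hw1
    value_mem := by
      show clo ≤ avgPairCorr L r ((((eucNorm v)⁻¹ : ℝ) : ℂ) • v) ∧
        avgPairCorr L r ((((eucNorm v)⁻¹ : ℝ) : ℂ) • v) ≤ chi
      rw [avgPairCorr_real_smul]
      obtain ⟨hlo, hhi⟩ := value_mem
      have hsinv : (eucNorm v)⁻¹ ^ 2 = s⁻¹ := by rw [← hv2, inv_pow]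
      rw [hsinv]
      constructor
      · rw [le_inv_mul_iff₀ hs0]; linarith
      · rw [inv_mul_le_iff₀ hs0]; linarith }

/-- **The §5 multiplet certificate from an ORTHOGONAL (not orthonormal) family (proved).** Inputs:
`v_i` in the sector with `⟨v_i, v_j⟩ = δ_ij s_i`, `s_i > 0`; a member `i₀` with `re ⟨v_i₀, H v_i₀⟩ ≤ ρ s_i₀`;
`‖H v_i - σ_i v_i‖² ≤ ε² s_i`; `ρ < β ≤` the Rayleigh quotient on unit sector vectors orthogonal to every
`v_i`; the span enclosure (see `value_range_of_form_bounds`). [folklore] -/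
def ResidualComplementMultipletData.ofOrthogonal {m : ℕ} (v : Fin m → Fock (Orb (FermionTorus 2 L)))
    (σ : Fin m → ℂ) (s : Fin m → ℝ) (ρ ε β glo ghi : ℝ) (i₀ : Fin m) (herm : (H L).IsHermitian)
    (mem : ∀ i, v i ∈ szSector (Λ := FermionTorus 2 L) (N L) 0)
    (horth : ∀ i j, star (v i) ⬝ᵥ v j = if i = j then ((s i : ℝ) : ℂ) else 0)
    (hs0 : ∀ i, 0 < s i) (rayleigh_le : (star (v i₀) ⬝ᵥ (H L) *ᵥ v i₀).re ≤ ρ * s i₀) (hε : 0 ≤ ε)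
    (residual_sq_le : ∀ i, eucNorm ((H L) *ᵥ v i - σ i • v i) ^ 2 ≤ ε ^ 2 * s i) (gap : ρ < β)
    (complement : ∀ w ∈ szSector (Λ := FermionTorus 2 L) (N L) 0, (∀ i, star (v i) ⬝ᵥ w = 0) →
      star w ⬝ᵥ w = 1 → β ≤ (star w ⬝ᵥ (H L) *ᵥ w).re)
    (value_range : ∀ u ∈ Submodule.span ℂ (Set.range v),
      1 - (m * ε / (β - ρ)) ^ 2 ≤ eucNorm u ^ 2 → eucNorm u ≤ 1 →
        glo ≤ avgPairCorr L r u ∧ avgPairCorr L r u ≤ ghi) :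
    ResidualComplementMultipletData H N L r :=
  have hv2 : ∀ i, eucNorm (v i) ^ 2 = s i := fun i =>
    eucNorm_sq_eq_of_star_dotProduct_self (by rw [horth i i, if_pos rfl])
  have hn0 : ∀ i, eucNorm (v i) ≠ 0 := fun i => eucNorm_ne_zero_of_sq_eq (hv2 i) (hs0 i)
  { m := m
    φ := fun i => normScalar (v i) • v i
    σ := σ
    ρ := ρ
    ε := ε
    β := β
    glo := glo
    ghi := ghi
    herm := herm
    mem := fun i => Submodule.smul_mem _ _ (mem i)
    orth := fun i j => by
      by_cases hij : i = j
      · subst hij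
        rw [if_pos rfl]
        exact star_normScalar_smul_dotProduct_self (hn0 i)
      · rw [if_neg hij, star_smul, smul_dotProduct, dotProduct_smul, horth, if_neg hij, smul_zero,
          smul_zero]
    energy_le := energy_le_of_rayleigh herm (Submodule.smul_mem _ _ (mem i₀))
      (star_normScalar_smul_dotProduct_self (hn0 i₀)) (re_rayleigh_normalize_le (hv2 i₀) (hs0 i₀)
        rayleigh_le)
    residual_le := fun i => eucNorm_residual_normalize_le (hv2 i) (hs0 i) hε (residual_sq_le i)
    gap := gap
    complement := fun w hw hφw hw1 =>
      complement w hw (fun i => star_dotProduct_eq_zero_of_normalize (hn0 i) (hφw i)) hw1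
    value_range := fun u hu hlo hhi => by
      refine value_range u ?_ hlo hhi
      refine (Submodule.span_le.2 ?_ ) hu
      rintro _ ⟨i, rfl⟩
      exact Submodule.smul_mem _ _ (Submodule.subset_span ⟨i, rfl⟩) }

/-- **Span enclosure from two quadratic-form bounds (proved).** If for all coefficient vectors `b`,
`g⁻ Σ|bᵢ|² sᵢ ≤ P̄_d(L, r; Σ bᵢ vᵢ) ≤ g⁺ Σ|bᵢ|² sᵢ` (two `m × m` matrix inequalities for the producer),
then on the shell `t₀ ≤ ‖u‖² ≤ 1` of the span, `min (g⁻ t₀) g⁻ ≤ P̄_d(L, r; u) ≤ max g⁺ (g⁺ t₀)`.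
[folklore] -/
theorem value_range_of_form_bounds {m : ℕ} {v : Fin m → Fock (Orb (FermionTorus 2 L))}
    {s : Fin m → ℝ} {gm gp t₀ : ℝ}
    (horth : ∀ i j, star (v i) ⬝ᵥ v j = if i = j then ((s i : ℝ) : ℂ) else 0)
    (hG : ∀ b : Fin m → ℂ, gm * (∑ i, ‖b i‖ ^ 2 * s i) ≤ avgPairCorr L r (∑ i, b i • v i) ∧
      avgPairCorr L r (∑ i, b i • v i) ≤ gp * (∑ i, ‖b i‖ ^ 2 * s i)) :
    ∀ u ∈ Submodule.span ℂ (Set.range v), t₀ ≤ eucNorm u ^ 2 → eucNorm u ≤ 1 →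
      min (gm * t₀) gm ≤ avgPairCorr L r u ∧ avgPairCorr L r u ≤ max gp (gp * t₀) := by
  intro u hu hlo hhi
  obtain ⟨b, rfl⟩ := (Submodule.mem_span_range_iff_exists_fun ℂ).1 hu
  have hns : ∑ i, ‖b i‖ ^ 2 * s i = eucNorm (∑ i, b i • v i) ^ 2 :=
    (eucNorm_sq_sum_smul_orthogonal horth b).symm
  obtain ⟨h1, h2⟩ := hG b
  rw [hns] at h1 h2
  set t := eucNorm (∑ i, b i • v i) ^ 2 with ht
  have ht1 : t ≤ 1 := by
    rw [ht]; nlinarith [eucNorm_nonneg (∑ i, b i • v i)]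
  constructor
  · refine le_trans ?_ h1
    rcases le_or_gt 0 gm with hg | hg
    · exact (min_le_left _ _).trans (mul_le_mul_of_nonneg_left hlo hg)
    · refine (min_le_right _ _).trans ?_
      have : gm * t ≥ gm * 1 := mul_le_mul_of_nonpos_left ht1 hg.le
      linarith
  · refine h2.trans ?_
    rcases le_or_gt 0 gp with hg | hg
    · refine le_trans ?_ (le_max_left _ _)
      have : gp * t ≤ gp * 1 := mul_le_mul_of_nonneg_left ht1 hg
      linarith
    · exact (mul_le_mul_of_nonpos_left hlo hg.le).trans (le_max_right _ _)

end Unnormalised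

end

end Summit.HubbardSuperconductivity.HubbardLadder
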